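import Literature.NumberTheory.Sieve.FriedlanderIwaniecPrimesDirichletBilinearBound
import Mathlib.Analysis.PSeries
import HarnessLib

/-!
# Friedlander–Iwaniec, *The polynomial `X² + Y⁴` captures its primes*, §21: Proposition 21.3 as printed (general `z`)

Family `parity`, statement parity.S17. Source: J. Friedlander, H. Iwaniec, Ann. of Math. (2) 148 (1998),
945–1040 [FriedlanderIwaniecAnnals1998], §21, Proposition 21.3 (21.10): "For any complex coefficients
`α_w, β_z` supported in the discs (21.2), (21.3) and satisfying (21.4), (21.5) respectively we have
`Q(M, N) ≪ (M+N)^{1/12} (MN)^{11/12+ε}`, where the implied constant depends only on `ε`"; here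
`Q(M, N) = Σ*_w Σ_z α_w β_z (z/w)` ((21.1)), the `*` restricting `w` to primary primitive numbers, `z`
running over ALL Gaussian integers with `|z|² ≤ N`. The source obtains it from the bound for `Q*` (both
variables primary primitive) "through the following arrangement:
`Q(M, N) = Σ_d Σ*_w Σ*_z α_w β_{dz} (d/ww̄)(z/w) = Σ_d Q*(M, Nd⁻²)`".

Everything here is PROVED, from `norm_dirichletBilinStar_le` (Proposition 21.3 for `Q*`,
`FriedlanderIwaniecPrimesDirichletBilinearBound`):

* `norm_dirichletBilin_disc_le` — **Proposition 21.3**: for every `ε > 0` there is `C` with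
  `‖Σ_{w pp, |w|² ≤ M} Σ_{|z|² ≤ N} α_w β_z (z/w)‖ ≤ C (M+N)^{1/12} (MN)^{11/12+ε}` for all `M, N ≥ 1` and all
  `|α|, |β| ≤ 1`.

The "arrangement" made precise: every nonzero `z ∈ ℤ[i]` is uniquely `z = g ρ z₀` with `g = (Re z, Im z) ≥ 1`,
`z₀` primary primitive and `ρ` one of the eight numbers `{±1, ±i} ∪ (1+i){±1, ±i}` (`unitClasses`;
`exists_decomp`, `decomp_unique` — the source's rational `d` silently absorbs the unit and the possible factor
`1 + i`); by complete multiplicativity `(gρz₀/w) = (g/|w|²)(ρ/w)(z₀/w)` with the first two factors absorbed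
into `α_w`, so `Q` minus its (trivial) `z = 0` term is `Σ_{g ≤ N} Σ_ρ Q*(M, N/(g²|ρ|²))` with twisted bounded
coefficients, and `Σ_g g^{-11/6} < ∞`.

With this file §21 of the source is complete up to Proposition 21.3; Proposition 21.4 (the form `K(M, N)` in
Jacobi–Kubota symbols, via Lemma 20.1 of `FriedlanderIwaniecPrimesJacobiKubota` and the Fourier expansion
(20.16)–(20.19)) is not here.

## References

* J. Friedlander, H. Iwaniec, Ann. of Math. (2) 148 (1998), 945–1040, §21, (21.1)–(21.5), (21.10),
  Proposition 21.3. [FriedlanderIwaniecAnnals1998]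
-/

noncomputable section

open Finset
open scoped NumberTheorySymbols

namespace Literature.NumberTheory.Sieve.FriedlanderIwaniecPrimes

open Literature.NumberTheory.QuadraticFields.GaussianPrimary
open Literature.NumberTheory.LFunctions.GaussianInt (IsPrimitive)

/-! ### The disc `|z|² ≤ N` and the eight classes `ρ` -/

/-- All Gaussian integers `z` with `|z|² ≤ N` (the support (21.3) of `β`). [cite: FriedlanderIwaniecAnnals1998, (21.3)] -/
def gaussDisc (N : ℕ) : Finset GaussianInt := (gaussBox N).filter fun z => z.norm ≤ N

/-- Membership in the disc. [folklore] -/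
theorem mem_gaussDisc {N : ℕ} {z : GaussianInt} : z ∈ gaussDisc N ↔ z.norm ≤ N := by
  rw [gaussDisc, mem_filter]
  exact ⟨fun h => h.2, fun h => ⟨mem_gaussBox_of_norm_le h, h⟩⟩

/-- The four units `±1, ±i` of `ℤ[i]`. [folklore] -/
def gaussUnits : Finset GaussianInt := {1, -1, ⟨0, 1⟩, ⟨0, -1⟩}

/-- The eight classes `ρ ∈ {±1, ±i} ∪ (1 + i){±1, ±i}`. [folklore] -/
def unitClasses : Finset GaussianInt := gaussUnits ∪ gaussUnits.image fun u => (⟨1, 1⟩ : GaussianInt) * u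

/-- A unit of `ℤ[i]` is one of `±1, ±i`. [folklore] -/
theorem mem_gaussUnits_of_isUnit {u : GaussianInt} (hu : IsUnit u) : u ∈ gaussUnits := by
  rcases eq_of_isUnit hu with rfl | rfl | rfl | rfl <;> simp [gaussUnits]

/-- The elements of `gaussUnits` are units. [folklore] -/
theorem isUnit_of_mem_gaussUnits {u : GaussianInt} (hu : u ∈ gaussUnits) : IsUnit u := by
  simp only [gaussUnits, mem_insert, mem_singleton] at hu
  rcases hu with rfl | rfl | rfl | rfl
  · exact isUnit_one
  · exact isUnit_one.neg
  · exact isUnit_I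
  · exact isUnit_I.neg

/-- Every element of `gaussUnits` has an inverse in `gaussUnits`. [folklore] -/
theorem exists_inv_mem_gaussUnits {u : GaussianInt} (hu : u ∈ gaussUnits) : ∃ u' ∈ gaussUnits, u' * u = 1 := by
  simp only [gaussUnits, mem_insert, mem_singleton] at hu
  rcases hu with rfl | rfl | rfl | rfl
  · exact ⟨1, by simp [gaussUnits], by ring⟩
  · exact ⟨-1, by simp [gaussUnits], by ring⟩
  · exact ⟨⟨0, -1⟩, by simp [gaussUnits], by ext <;> simp [Zsqrtd.re_mul, Zsqrtd.im_mul]⟩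
  · exact ⟨⟨0, 1⟩, by simp [gaussUnits], by ext <;> simp [Zsqrtd.re_mul, Zsqrtd.im_mul]⟩

/-- `ρ ∈ unitClasses` iff `ρ = (1 + i)^a u` with `a ≤ 1` and `u` a unit. [folklore] -/
theorem mem_unitClasses_iff {ρ : GaussianInt} :
    ρ ∈ unitClasses ↔ ∃ a : ℕ, a ≤ 1 ∧ ∃ u ∈ gaussUnits, ρ = (⟨1, 1⟩ : GaussianInt) ^ a * u := by
  rw [unitClasses, mem_union, mem_image]
  constructor
  · rintro (h | ⟨u, hu, rfl⟩)
    · exact ⟨0, by norm_num, ρ, h, by simp⟩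
    · exact ⟨1, le_rfl, u, hu, by simp⟩
  · rintro ⟨a, ha, u, hu, rfl⟩
    interval_cases a
    · left; simpa using hu
    · right; exact ⟨u, hu, by simp⟩

/-- The norm of `(1 + i)^a u` is `2^a`. [folklore] -/
theorem norm_one_add_I_pow_mul {a : ℕ} {u : GaussianInt} (hu : u ∈ gaussUnits) :
    ((⟨1, 1⟩ : GaussianInt) ^ a * u).norm = 2 ^ a := by
  rw [Zsqrtd.norm_mul, (Zsqrtd.norm_eq_one_iff' (by norm_num) u).mpr (isUnit_of_mem_gaussUnits hu), mul_one,
    show ((⟨1, 1⟩ : GaussianInt) ^ a).norm = ((⟨1, 1⟩ : GaussianInt).norm) ^ a from map_pow Zsqrtd.normMonoidHom _ _]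
  norm_num [Zsqrtd.norm_def]

/-- Elements of `unitClasses` are nonzero. [folklore] -/
theorem ne_zero_of_mem_unitClasses {ρ : GaussianInt} (hρ : ρ ∈ unitClasses) : ρ ≠ 0 := by
  obtain ⟨a, -, u, hu, rfl⟩ := mem_unitClasses_iff.mp hρ
  intro h
  have := norm_one_add_I_pow_mul (a := a) hu
  rw [h, Zsqrtd.norm_zero] at this
  exact absurd this (by positivity)

/-- `1 ≤ |ρ|² ≤ 2` on `unitClasses`. [folklore] -/
theorem norm_mem_unitClasses {ρ : GaussianInt} (hρ : ρ ∈ unitClasses) : 1 ≤ ρ.norm.natAbs ∧ ρ.norm.natAbs ≤ 2 := by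
  obtain ⟨a, ha, u, hu, rfl⟩ := mem_unitClasses_iff.mp hρ
  rw [norm_one_add_I_pow_mul hu]
  interval_cases a <;> simp

/-! ### Primitivity under units and `1 + i` -/

/-- Multiplication by a unit preserves primitivity. [folklore] -/
theorem isPrimitive_mul_of_mem_gaussUnits {u z : GaussianInt} (hu : u ∈ gaussUnits) (hz : IsPrimitive z) :
    IsPrimitive (u * z) := by
  rw [isPrimitive_iff] at hz ⊢
  simp only [gaussUnits, mem_insert, mem_singleton] at hu
  rcases hu with rfl | rfl | rfl | rfl
  · simpa using hz
  · have e1 : (-1 * z).re = -z.re := by simp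
    have e2 : (-1 * z).im = -z.im := by simp
    rw [e1, e2, Int.neg_gcd, Int.gcd_neg]; exact hz
  · rw [re_I_mul, im_I_mul, Int.neg_gcd, Int.gcd_comm]; exact hz
  · have e1 : ((⟨0, -1⟩ : GaussianInt) * z).re = z.im := by simp [Zsqrtd.re_mul]
    have e2 : ((⟨0, -1⟩ : GaussianInt) * z).im = -z.re := by simp [Zsqrtd.im_mul]
    rw [e1, e2, Int.gcd_neg, Int.gcd_comm]; exact hz

/-- `(1 + i) z` is primitive when `z` is primitive with `Re z + Im z` odd (its coordinates `Re z ∓ Im z` are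
odd, and a common divisor divides `2 Re z` and `2 Im z`). [folklore] -/
theorem isPrimitive_one_add_I_mul {z : GaussianInt} (hodd : (z.re + z.im) % 2 = 1) (hz : IsPrimitive z) :
    IsPrimitive ((⟨1, 1⟩ : GaussianInt) * z) := by
  rw [isPrimitive_iff] at hz ⊢
  have ere : ((⟨1, 1⟩ : GaussianInt) * z).re = z.re - z.im := by simp only [Zsqrtd.re_mul]; ring
  have eim : ((⟨1, 1⟩ : GaussianInt) * z).im = z.re + z.im := by simp only [Zsqrtd.im_mul]; ring
  rw [ere, eim]
  set d := Int.gcd (z.re - z.im) (z.re + z.im) with hd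
  have h1 : (d : ℤ) ∣ z.re - z.im := Int.gcd_dvd_left _ _
  have h2 : (d : ℤ) ∣ z.re + z.im := Int.gcd_dvd_right _ _
  have h3 : (d : ℤ) ∣ 2 * z.re := by have := h1.add h2; rwa [show z.re - z.im + (z.re + z.im) = 2 * z.re by ring] at this
  have h4 : (d : ℤ) ∣ 2 * z.im := by have := h2.sub h1; rwa [show z.re + z.im - (z.re - z.im) = 2 * z.im by ring] at this
  have h5 : (d : ℤ) ∣ (Int.gcd (2 * z.re) (2 * z.im) : ℤ) := Int.dvd_coe_gcd h3 h4
  rw [Int.gcd_mul_left, hz] at h5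
  norm_num at h5
  have h6 : d ∣ 2 := by exact_mod_cast h5
  have h7 : ¬ 2 ∣ d := by
    intro h
    have : (2 : ℤ) ∣ z.re - z.im := (Int.natCast_dvd_natCast.mpr h).trans h1
    omega
  rcases (Nat.dvd_prime Nat.prime_two).mp h6 with h | h
  · exact h
  · omega

/-- `ρ z₀` is primitive for `ρ ∈ unitClasses` and `z₀` primary primitive. [folklore] -/
theorem isPrimitive_unitClass_mul {ρ z₀ : GaussianInt} (hρ : ρ ∈ unitClasses) (h₀ : IsPrimary z₀)
    (h₀' : IsPrimitive z₀) : IsPrimitive (ρ * z₀) := by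
  obtain ⟨a, ha, u, hu, rfl⟩ := mem_unitClasses_iff.mp hρ
  have huz : IsPrimitive (u * z₀) := isPrimitive_mul_of_mem_gaussUnits hu h₀'
  interval_cases a
  · simpa using huz
  · rw [pow_one, mul_assoc]
    refine isPrimitive_one_add_I_mul ?_ huz
    rw [← norm_emod_two, Zsqrtd.norm_mul, (Zsqrtd.norm_eq_one_iff' (by norm_num) u).mpr (isUnit_of_mem_gaussUnits hu),
      one_mul]
    exact h₀.norm_odd

/-! ### The decomposition `z = g ρ z₀` -/

/-- Coordinates of `(g : ℤ[i]) * x`. [folklore] -/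
theorem natCast_mul_re_im (g : ℕ) (x : GaussianInt) :
    ((g : GaussianInt) * x).re = g * x.re ∧ ((g : GaussianInt) * x).im = g * x.im := by
  constructor <;> simp [Zsqrtd.re_mul, Zsqrtd.im_mul]

/-- The gcd of the coordinates of `g ρ z₀` is `g`. [folklore] -/
theorem gcd_re_im_decomp {g : ℕ} {ρ z₀ : GaussianInt} (hρ : ρ ∈ unitClasses) (h₀ : IsPrimary z₀)
    (h₀' : IsPrimitive z₀) :
    Int.gcd ((g : GaussianInt) * (ρ * z₀)).re ((g : GaussianInt) * (ρ * z₀)).im = g := by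
  obtain ⟨e1, e2⟩ := natCast_mul_re_im g (ρ * z₀)
  rw [e1, e2, Int.gcd_mul_left, (isPrimitive_iff _).mp (isPrimitive_unitClass_mul hρ h₀ h₀')]
  simp

/-- An odd primitive `x` (i.e. `Re x + Im x` odd) is a unit times a primary primitive number. [folklore] -/
theorem exists_unit_mul_primary {x : GaussianInt} (hodd : (x.re + x.im) % 2 = 1) (hx : IsPrimitive x) :
    ∃ u ∈ gaussUnits, ∃ z₀ : GaussianInt, IsPrimary z₀ ∧ IsPrimitive z₀ ∧ x = u * z₀ := by
  obtain ⟨u, hu, hpu⟩ := exists_isUnit_primary_eq hodd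
  have hu' := mem_gaussUnits_of_isUnit hu
  obtain ⟨u', hu'mem, hu'u⟩ := exists_inv_mem_gaussUnits hu'
  refine ⟨u', hu'mem, primary x, isPrimary_primary hodd, ?_, ?_⟩
  · rw [hpu]; exact isPrimitive_mul_of_mem_gaussUnits hu' hx
  · rw [hpu, ← mul_assoc, hu'u, one_mul]

/-- **Existence of the decomposition**: every nonzero `z` is `g ρ z₀` with `g = (Re z, Im z)`,
`ρ ∈ unitClasses`, `z₀` primary primitive. [folklore] -/
theorem exists_decomp {z : GaussianInt} (hz : z ≠ 0) :
    ∃ ρ ∈ unitClasses, ∃ z₀ : GaussianInt, IsPrimary z₀ ∧ IsPrimitive z₀ ∧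
      z = ((Int.gcd z.re z.im : ℕ) : GaussianInt) * (ρ * z₀) := by
  set g := Int.gcd z.re z.im with hg
  have hg0 : 0 < g := Int.gcd_pos_iff.mpr (by
    by_contra h
    push Not at h
    exact hz (Zsqrtd.ext h.1 h.2))
  have hre : (g : ℤ) ∣ z.re := Int.gcd_dvd_left _ _
  have him : (g : ℤ) ∣ z.im := Int.gcd_dvd_right _ _
  set z₁ : GaussianInt := ⟨z.re / g, z.im / g⟩ with hz₁
  have hz₁p : IsPrimitive z₁ := by
    rw [isPrimitive_iff]; exact Int.gcd_div_gcd_div_gcd hg0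
  have hzz₁ : z = (g : GaussianInt) * z₁ := by
    ext
    · rw [(natCast_mul_re_im g z₁).1]; exact (Int.mul_ediv_cancel' hre).symm
    · rw [(natCast_mul_re_im g z₁).2]; exact (Int.mul_ediv_cancel' him).symm
  by_cases hpar : (z₁.re + z₁.im) % 2 = 1
  · obtain ⟨u, hu, z₀, h₀, h₀', hx⟩ := exists_unit_mul_primary hpar hz₁p
    refine ⟨u, mem_union_left _ hu, z₀, h₀, h₀', ?_⟩
    rw [hzz₁, hx]
  · -- both coordinates odd: `z₁ = (1 + i) z₂`
    have hco : Int.gcd z₁.re z₁.im = 1 := hz₁p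
    have hodd₁ : z₁.re % 2 = 1 ∧ z₁.im % 2 = 1 := by
      rcases Int.emod_two_eq_zero_or_one z₁.re with h1 | h1 <;>
        rcases Int.emod_two_eq_zero_or_one z₁.im with h2 | h2
      · exfalso
        have h3 : (2 : ℤ) ∣ (Int.gcd z₁.re z₁.im : ℤ) :=
          Int.dvd_coe_gcd (Int.dvd_of_emod_eq_zero h1) (Int.dvd_of_emod_eq_zero h2)
        rw [hco] at h3; norm_num at h3
      · exfalso; omega
      · exfalso; omega
      · exact ⟨h1, h2⟩
    obtain ⟨a, ha⟩ : ∃ a, z₁.re + z₁.im = 2 * a := ⟨(z₁.re + z₁.im) / 2, by omega⟩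
    obtain ⟨b, hb⟩ : ∃ b, z₁.im - z₁.re = 2 * b := ⟨(z₁.im - z₁.re) / 2, by omega⟩
    set z₂ : GaussianInt := ⟨a, b⟩ with hz₂
    have hz₁₂ : z₁ = (⟨1, 1⟩ : GaussianInt) * z₂ := by
      ext <;> simp [Zsqrtd.re_mul, Zsqrtd.im_mul, hz₂] <;> omega
    have hz₂p : IsPrimitive z₂ := by
      rw [isPrimitive_iff]
      have h1 : ((Int.gcd a b : ℕ) : ℤ) ∣ z₁.re := by
        have : z₁.re = a - b := by omega
        rw [this]; exact (Int.gcd_dvd_left _ _).sub (Int.gcd_dvd_right _ _)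
      have h2 : ((Int.gcd a b : ℕ) : ℤ) ∣ z₁.im := by
        have : z₁.im = a + b := by omega
        rw [this]; exact (Int.gcd_dvd_left _ _).add (Int.gcd_dvd_right _ _)
      have h3 := Int.dvd_coe_gcd h1 h2
      rw [hco, Nat.cast_one] at h3
      have : Int.gcd a b ∣ 1 := by exact_mod_cast h3
      simpa using Nat.dvd_one.mp this
    have hpar₂ : (z₂.re + z₂.im) % 2 = 1 := by simp only [hz₂]; omega
    obtain ⟨u, hu, z₀, h₀, h₀', hx⟩ := exists_unit_mul_primary hpar₂ hz₂p
    refine ⟨⟨1, 1⟩ * u, mem_union_right _ (mem_image_of_mem _ hu), z₀, h₀, h₀', ?_⟩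
    rw [hzz₁, hz₁₂, hx]; ring

/-- **Uniqueness of the decomposition** `g ρ z₀`. [folklore] -/
theorem decomp_unique {g g' : ℕ} (hg : 0 < g) {ρ ρ' z₀ z₀' : GaussianInt} (hρ : ρ ∈ unitClasses)
    (hρ' : ρ' ∈ unitClasses) (h₀ : IsPrimary z₀) (h₀p : IsPrimitive z₀) (h₀' : IsPrimary z₀')
    (h₀p' : IsPrimitive z₀') (heq : (g : GaussianInt) * (ρ * z₀) = (g' : GaussianInt) * (ρ' * z₀')) :
    g = g' ∧ ρ = ρ' ∧ z₀ = z₀' := by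
  -- the gcd of the coordinates gives `g = g'`
  have hgg : g = g' := by
    have h1 := gcd_re_im_decomp (g := g) hρ h₀ h₀p
    have h2 := gcd_re_im_decomp (g := g') hρ' h₀' h₀p'
    rw [heq] at h1
    exact h1.symm.trans h2
  subst hgg
  have hg0 : (g : GaussianInt) ≠ 0 := by exact_mod_cast hg.ne'
  have heq' : ρ * z₀ = ρ' * z₀' := mul_left_cancel₀ hg0 heq
  obtain ⟨a, ha, u, hu, rfl⟩ := mem_unitClasses_iff.mp hρ
  obtain ⟨a', ha', u', hu', rfl⟩ := mem_unitClasses_iff.mp hρ'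
  -- norms: `2^a |z₀|² = 2^{a'} |z₀'|²` with odd `|z₀|²`, so `a = a'`
  have hnorm : (2 : ℤ) ^ a * z₀.norm = 2 ^ a' * z₀'.norm := by
    have := congrArg Zsqrtd.norm heq'
    rwa [Zsqrtd.norm_mul (_ ^ a * u) z₀, Zsqrtd.norm_mul (_ ^ a' * u') z₀', norm_one_add_I_pow_mul hu,
      norm_one_add_I_pow_mul hu'] at this
  have hodd := h₀.norm_odd
  have hodd' := h₀'.norm_odd
  have haa : a = a' := by
    interval_cases a <;> interval_cases a'
    · rfl
    · exfalso; simp at hnorm; omega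
    · exfalso; simp at hnorm; omega
    · rfl
  subst haa
  -- cancel `(1 + i)^a` and compare the unit parts
  have hc0 : ((⟨1, 1⟩ : GaussianInt) ^ a) ≠ 0 := pow_ne_zero _ (by decide)
  have heq'' : u * z₀ = u' * z₀' := by
    rw [mul_assoc, mul_assoc] at heq'
    exact mul_left_cancel₀ hc0 heq'
  have hz : z₀ = z₀' := by
    refine h₀.eq_of_associated h₀' ?_
    have h1 : Associated (u * z₀) (u' * z₀') := by rw [heq'']
    exact (associated_isUnit_mul_right_iff (isUnit_of_mem_gaussUnits hu')).mp
      ((associated_isUnit_mul_left_iff (isUnit_of_mem_gaussUnits hu)).mp h1)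
  subst hz
  have hu_eq : u = u' := mul_right_cancel₀ h₀.ne_zero heq''
  subst hu_eq
  exact ⟨rfl, rfl, rfl⟩

/-! ### The reindexing of `Σ_{z ≠ 0, |z|² ≤ N}` -/

/-- The index set of the decomposition: `(g, ρ)` with `1 ≤ g ≤ N`, `ρ ∈ unitClasses`, and `z₀` primary primitive
with `|z₀|² ≤ N/(g² |ρ|²)`. [folklore] -/
def decompIndex (N : ℕ) : Finset (Σ _ : ℕ × GaussianInt, GaussianInt) :=
  ((Icc 1 N) ×ˢ unitClasses).sigma fun p => ppDisc (N / (p.1 ^ 2 * p.2.norm.natAbs))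

/-- The decomposition map `(g, ρ, z₀) ↦ g ρ z₀`. [folklore] -/
def decompMap (x : Σ _ : ℕ × GaussianInt, GaussianInt) : GaussianInt := (x.1.1 : GaussianInt) * (x.1.2 * x.2)

/-- Norm of `g ρ z₀`. [folklore] -/
theorem natAbs_norm_decompMap (x : Σ _ : ℕ × GaussianInt, GaussianInt) :
    (decompMap x).norm.natAbs = x.1.1 ^ 2 * x.1.2.norm.natAbs * x.2.norm.natAbs := by
  rw [decompMap, Zsqrtd.norm_mul, Zsqrtd.norm_mul, Int.natAbs_mul, Int.natAbs_mul, Zsqrtd.norm_natCast, Int.natAbs_mul,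
    Int.natAbs_natCast]
  ring

/-- **`Σ_{0 ≠ z, |z|² ≤ N} F(z) = Σ_{g ≤ N} Σ_ρ Σ_{z₀ pp, |z₀|² ≤ N/(g²|ρ|²)} F(g ρ z₀)`.** [folklore] -/
theorem sum_gaussDisc_erase_zero_eq {M : Type*} [AddCommMonoid M] (N : ℕ) (F : GaussianInt → M) :
    ∑ z ∈ (gaussDisc N).erase 0, F z = ∑ x ∈ decompIndex N, F (decompMap x) := by
  classical
  symm
  refine sum_bij (fun x _ => decompMap x) ?_ ?_ ?_ (fun _ _ => rfl)
  · -- maps into the punctured disc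
    intro x hx
    rw [decompIndex, mem_sigma, mem_product, mem_Icc] at hx
    obtain ⟨⟨⟨hg1, hgN⟩, hρ⟩, hz₀⟩ := hx
    obtain ⟨h₀, h₀', hn⟩ := mem_ppDisc.mp hz₀
    rw [mem_erase]
    refine ⟨?_, mem_gaussDisc.mpr ?_⟩
    · rw [decompMap]
      exact mul_ne_zero (by exact_mod_cast (show x.1.1 ≠ 0 by omega))
        (mul_ne_zero (ne_zero_of_mem_unitClasses hρ) h₀.ne_zero)
    · have hq : 0 < x.1.1 ^ 2 * x.1.2.norm.natAbs := by
        have := (norm_mem_unitClasses hρ).1; positivity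
      have hn' : x.2.norm.natAbs ≤ N / (x.1.1 ^ 2 * x.1.2.norm.natAbs) := by
        have : (x.2.norm.natAbs : ℤ) ≤ (N / (x.1.1 ^ 2 * x.1.2.norm.natAbs) : ℕ) := by
          rw [GaussianInt.abs_natCast_norm]; exact hn
        exact_mod_cast this
      have h1 : (decompMap x).norm.natAbs ≤ N := by
        rw [natAbs_norm_decompMap]
        calc x.1.1 ^ 2 * x.1.2.norm.natAbs * x.2.norm.natAbs
            ≤ x.1.1 ^ 2 * x.1.2.norm.natAbs * (N / (x.1.1 ^ 2 * x.1.2.norm.natAbs)) := Nat.mul_le_mul_left _ hn'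
          _ ≤ N := Nat.mul_div_le N _
      have : ((decompMap x).norm.natAbs : ℤ) ≤ N := by exact_mod_cast h1
      rwa [GaussianInt.abs_natCast_norm] at this
  · -- injective
    intro x hx x' hx' h
    rw [decompIndex, mem_sigma, mem_product, mem_Icc] at hx hx'
    obtain ⟨⟨⟨hg1, -⟩, hρ⟩, hz₀⟩ := hx
    obtain ⟨⟨⟨hg1', -⟩, hρ'⟩, hz₀'⟩ := hx'
    obtain ⟨h₀, h₀p, -⟩ := mem_ppDisc.mp hz₀
    obtain ⟨h₀', h₀p', -⟩ := mem_ppDisc.mp hz₀'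
    obtain ⟨h1, h2, h3⟩ := decomp_unique (by omega) hρ hρ' h₀ h₀p h₀' h₀p' h
    rcases x with ⟨⟨g, ρ⟩, z₀⟩
    rcases x' with ⟨⟨g', ρ'⟩, z₀'⟩
    simp only at h1 h2 h3
    subst h1; subst h2; subst h3
    rfl
  · -- surjective
    intro z hz
    rw [mem_erase, mem_gaussDisc] at hz
    obtain ⟨hz0, hzN⟩ := hz
    obtain ⟨ρ, hρ, z₀, h₀, h₀', hdec⟩ := exists_decomp hz0
    set g := Int.gcd z.re z.im with hg
    have hg0 : 0 < g := Int.gcd_pos_iff.mpr (by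
      by_contra h
      push Not at h
      exact hz0 (Zsqrtd.ext h.1 h.2))
    have hzn : z.norm.natAbs ≤ N := by
      have : (z.norm.natAbs : ℤ) ≤ N := by rw [GaussianInt.abs_natCast_norm]; exact hzN
      exact_mod_cast this
    have hnorm : z.norm.natAbs = g ^ 2 * ρ.norm.natAbs * z₀.norm.natAbs := by
      have := natAbs_norm_decompMap ⟨(g, ρ), z₀⟩
      rwa [decompMap, ← hdec] at this
    have hq : 0 < g ^ 2 * ρ.norm.natAbs := by have := (norm_mem_unitClasses hρ).1; positivity
    refine ⟨⟨(g, ρ), z₀⟩, ?_, hdec.symm⟩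
    rw [decompIndex, mem_sigma, mem_product, mem_Icc]
    refine ⟨⟨⟨hg0, ?_⟩, hρ⟩, mem_ppDisc.mpr ⟨h₀, h₀', ?_⟩⟩
    · -- `g ≤ g² ≤ |z|² ≤ N`
      have h1 : 1 ≤ z₀.norm.natAbs := Nat.pos_of_ne_zero (natAbs_norm_ne_zero_of_isPrimary h₀)
      have h2 : 1 ≤ ρ.norm.natAbs := (norm_mem_unitClasses hρ).1
      nlinarith
    · have : z₀.norm.natAbs ≤ N / (g ^ 2 * ρ.norm.natAbs) := by
        rw [Nat.le_div_iff_mul_le hq]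
        calc z₀.norm.natAbs * (g ^ 2 * ρ.norm.natAbs) = z.norm.natAbs := by rw [hnorm]; ring
          _ ≤ N := hzn
      have : (z₀.norm.natAbs : ℤ) ≤ (N / (g ^ 2 * ρ.norm.natAbs) : ℕ) := by exact_mod_cast this
      rwa [GaussianInt.abs_natCast_norm] at this

/-! ### Proposition 21.3 for general `z` -/

/-- There are at most eight classes `ρ`. [folklore] -/
theorem card_unitClasses_le : #unitClasses ≤ 8 := by
  have h4 : #gaussUnits ≤ 4 := card_le_four
  calc #unitClasses ≤ #gaussUnits + #(gaussUnits.image fun u => (⟨1, 1⟩ : GaussianInt) * u) := card_union_le _ _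
    _ ≤ 4 + 4 := Nat.add_le_add h4 (card_image_le.trans h4)
    _ = 8 := rfl

/-- `ppDisc 0 = ∅` (a primary number has norm `≥ 1`). [folklore] -/
theorem ppDisc_zero : ppDisc 0 = ∅ := by
  rw [eq_empty_iff_forall_notMem]
  intro w hw
  obtain ⟨hp, -, hn⟩ := mem_ppDisc.mp hw
  have h1 := natAbs_norm_ne_zero_of_isPrimary hp
  have : (w.norm.natAbs : ℤ) ≤ 0 := by rw [GaussianInt.abs_natCast_norm]; exact_mod_cast hn
  omega

/-- The `z = 0` term of `Q`: only `w = 1` has `(0/w) ≠ 0`, so `|Σ_{w pp, |w|² ≤ M} α_w (0/w)| ≤ 1`. [folklore] -/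
theorem norm_sum_ppDisc_dirichletSym_zero_le (M : ℕ) (α : GaussianInt → ℂ) (hα : ∀ w, ‖α w‖ ≤ 1) :
    ‖∑ w ∈ ppDisc M, α w * (dirichletSym 0 w : ℂ)‖ ≤ 1 := by
  classical
  have hterm : ∀ w ∈ ppDisc M, ‖α w * (dirichletSym 0 w : ℂ)‖ ≤ if w.norm.natAbs < 2 then 1 else 0 := by
    intro w _
    split_ifs with h
    · rw [norm_mul]
      exact mul_le_one₀ (hα w) (norm_nonneg _) (norm_cast_dirichletSym_le 0 w)
    · rw [dirichletSym_zero_of_two_le (by omega)]; simp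
  refine (norm_sum_le _ _).trans ((sum_le_sum hterm).trans ?_)
  rw [← sum_filter, sum_const, nsmul_eq_mul, mul_one]
  have : #((ppDisc M).filter fun w => w.norm.natAbs < 2) ≤ 1 := by
    rw [← card_singleton (1 : GaussianInt), ← primaryNormEq_one]
    refine card_le_card fun w hw => ?_
    rw [mem_filter] at hw
    obtain ⟨hw, h2⟩ := hw
    obtain ⟨hp, -, -⟩ := mem_ppDisc.mp hw
    have h0 := natAbs_norm_ne_zero_of_isPrimary hp
    have h1 : w.norm.natAbs = 1 := by omega
    refine mem_primaryNormEq.mpr ⟨?_, hp⟩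
    rw [← GaussianInt.abs_natCast_norm, h1]
  exact_mod_cast this

/-- `(g ρ z₀ / w) = J(g | |w|²) (ρ/w) (z₀/w)` for `w` primary primitive. [cite: FriedlanderIwaniecAnnals1998, §21 before Proposition 21.3] -/
theorem dirichletSym_decompMap {w : GaussianInt} (hw : IsPrimary w) (hw' : IsPrimitive w) (g : ℕ) (ρ z₀ : GaussianInt) :
    dirichletSym ((g : GaussianInt) * (ρ * z₀)) w = J((g : ℤ) | w.norm.natAbs) * dirichletSym ρ w * dirichletSym z₀ w := by
  rw [show ((g : GaussianInt)) = ((g : ℤ) : GaussianInt) by simp, dirichletSym_intCast_mul hw hw',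
    dirichletSym_mul_left hw hw', mul_assoc]

/-- **Friedlander–Iwaniec, Proposition 21.3** (as printed: `w` primary primitive, `z` arbitrary). For every
`ε > 0` there is `C` such that for all `M, N ≥ 1` and all coefficients `|α_w|, |β_z| ≤ 1`,
`|Σ_{w pp, |w|² ≤ M} Σ_{|z|² ≤ N} α_w β_z (z/w)| ≤ C (M + N)^{1/12} (MN)^{11/12 + ε}`.
[cite: FriedlanderIwaniecAnnals1998, Proposition 21.3] -/
theorem norm_dirichletBilin_disc_le {ε : ℝ} (hε : 0 < ε) :
    ∃ C : ℝ, 0 < C ∧ ∀ (M N : ℕ), 1 ≤ M → 1 ≤ N → ∀ (α β : GaussianInt → ℂ),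
      (∀ w, ‖α w‖ ≤ 1) → (∀ z, ‖β z‖ ≤ 1) →
        ‖dirichletBilin α β (ppDisc M) (gaussDisc N)‖ ≤
          C * ((M : ℝ) + N) ^ (1 / 12 : ℝ) * ((M : ℝ) * N) ^ (11 / 12 + ε) := by
  obtain ⟨C, hC, hstar⟩ := norm_dirichletBilinStar_le hε
  -- the convergent series `Σ g^{-11/6}`
  have hsum : Summable fun g : ℕ => (g : ℝ) ^ (-(11 / 6 : ℝ)) := Real.summable_nat_rpow.mpr (by norm_num)
  obtain ⟨Z, hZ⟩ : ∃ Z : ℝ, Z = ∑' g : ℕ, (g : ℝ) ^ (-(11 / 6 : ℝ)) := ⟨_, rfl⟩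
  have hZ0 : 0 ≤ Z := by rw [hZ]; exact tsum_nonneg fun g => by positivity
  refine ⟨1 + 8 * C * Z, by positivity, fun M N hM hN α β hα hβ => ?_⟩
  classical
  have hMr : (1 : ℝ) ≤ M := by exact_mod_cast hM
  have hNr : (1 : ℝ) ≤ N := by exact_mod_cast hN
  have hM0 : (0 : ℝ) < M := by linarith
  have hN0 : (0 : ℝ) < N := by linarith
  set e : ℝ := 11 / 12 + ε with he
  have he0 : 0 ≤ e := by rw [he]; linarith
  obtain ⟨R, hR⟩ : ∃ R : ℝ, R = ((M : ℝ) + N) ^ (1 / 12 : ℝ) * ((M : ℝ) * N) ^ e := ⟨_, rfl⟩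
  have hR1 : 1 ≤ R := by
    rw [hR]
    exact one_le_mul_of_one_le_of_one_le (Real.one_le_rpow (by linarith) (by norm_num))
      (Real.one_le_rpow (by nlinarith) he0)
  have hR0 : 0 ≤ R := by linarith
  -- `Q = Σ_z β_z A(z)`, split off `z = 0`
  set A : GaussianInt → ℂ := fun z => ∑ w ∈ ppDisc M, α w * (dirichletSym z w : ℂ) with hA
  have hQ : dirichletBilin α β (ppDisc M) (gaussDisc N) = β 0 * A 0 + ∑ z ∈ (gaussDisc N).erase 0, β z * A z := by
    rw [dirichletBilin_eq_sum_mul]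
    exact (add_sum_erase _ _ (mem_gaussDisc.mpr (by simp))).symm
  have h0 : ‖β 0 * A 0‖ ≤ 1 := by
    rw [norm_mul]
    exact mul_le_one₀ (hβ 0) (norm_nonneg _) (norm_sum_ppDisc_dirichletSym_zero_le M α hα)
  -- the main part, reindexed through `z = g ρ z₀`
  have hmain : ‖∑ z ∈ (gaussDisc N).erase 0, β z * A z‖ ≤ 8 * C * Z * R := by
    rw [sum_gaussDisc_erase_zero_eq N (fun z => β z * A z), decompIndex, sum_sigma]
    -- each `(g, ρ)`-piece is a `Q*` with twisted coefficients
    have hpiece : ∀ p ∈ (Icc 1 N) ×ˢ unitClasses,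
        ‖∑ z₀ ∈ ppDisc (N / (p.1 ^ 2 * p.2.norm.natAbs)), β (decompMap ⟨p, z₀⟩) * A (decompMap ⟨p, z₀⟩)‖ ≤
          C * R * (p.1 : ℝ) ^ (-(11 / 6 : ℝ)) := by
      intro p hp
      rw [mem_product, mem_Icc] at hp
      obtain ⟨⟨hg1, hgN⟩, hρ⟩ := hp
      set g := p.1 with hg
      set ρ := p.2 with hρdef
      set Np := N / (g ^ 2 * ρ.norm.natAbs) with hNp
      have hgr : (1 : ℝ) ≤ g := by exact_mod_cast hg1
      have hg0 : (0 : ℝ) < g := by linarith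
      -- twisted coefficients
      set α' : GaussianInt → ℂ := fun w => α w * (J((g : ℤ) | w.norm.natAbs) : ℂ) * (dirichletSym ρ w : ℂ) with hα'
      set β' : GaussianInt → ℂ := fun z₀ => β (decompMap ⟨p, z₀⟩) with hβ'
      have hα'1 : ∀ w, ‖α' w‖ ≤ 1 := by
        intro w
        rw [hα', norm_mul, norm_mul]
        refine mul_le_one₀ (mul_le_one₀ (hα w) (norm_nonneg _) ?_) (norm_nonneg _) (norm_cast_dirichletSym_le ρ w)
        rcases jacobiSym.trichotomy (g : ℤ) w.norm.natAbs with h | h | h <;> simp [h]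
      have hβ'1 : ∀ z, ‖β' z‖ ≤ 1 := fun z => hβ _
      have hident : ∑ z₀ ∈ ppDisc Np, β (decompMap ⟨p, z₀⟩) * A (decompMap ⟨p, z₀⟩) = dirichletBilinStar α' β' M Np := by
        rw [dirichletBilinStar, dirichletBilin_eq_sum_mul]
        refine sum_congr rfl fun z₀ _ => ?_
        rw [hβ']
        congr 1
        rw [hA]
        refine sum_congr rfl fun w hw => ?_
        obtain ⟨hwp, hwq, -⟩ := mem_ppDisc.mp hw
        rw [decompMap, hα']
        simp only
        rw [dirichletSym_decompMap hwp hwq]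
        push_cast; ring
      rw [hident]
      -- the bound for `Q*(M, Np)`
      rcases Nat.eq_zero_or_pos Np with hNp0 | hNp1
      · rw [hNp0, dirichletBilinStar, ppDisc_zero, dirichletBilin_def]
        simp only [sum_empty, sum_const_zero, norm_zero]
        positivity
      have hb := hstar M Np hM hNp1 α' β' hα'1 hβ'1
      refine hb.trans ?_
      have hNp_le : (Np : ℝ) ≤ N / (g : ℝ) ^ 2 := by
        rw [le_div_iff₀ (by positivity)]
        have h1 : Np * (g ^ 2 * ρ.norm.natAbs) ≤ N := Nat.div_mul_le_self N _
        have h2 : 1 ≤ ρ.norm.natAbs := (norm_mem_unitClasses hρ).1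
        have h3 : Np * g ^ 2 ≤ N := le_trans (Nat.mul_le_mul_left Np (Nat.le_mul_of_pos_right _ h2)) h1
        exact_mod_cast h3
      have hNpN : (Np : ℝ) ≤ N := by exact_mod_cast (Nat.div_le_self N _)
      have hA1 : ((M : ℝ) + Np) ^ (1 / 12 : ℝ) ≤ ((M : ℝ) + N) ^ (1 / 12 : ℝ) :=
        Real.rpow_le_rpow (by positivity) (by linarith) (by norm_num)
      have hA2 : ((M : ℝ) * Np) ^ e ≤ ((M : ℝ) * N) ^ e * (g : ℝ) ^ (-(11 / 6 : ℝ)) := by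
        calc ((M : ℝ) * Np) ^ e ≤ ((M : ℝ) * N / (g : ℝ) ^ 2) ^ e := by
              refine Real.rpow_le_rpow (by positivity) ?_ he0
              rw [mul_div_assoc]; exact mul_le_mul_of_nonneg_left hNp_le hM0.le
          _ = ((M : ℝ) * N) ^ e * (((g : ℝ) ^ 2) ^ e)⁻¹ := by
              rw [Real.div_rpow (by positivity) (by positivity), div_eq_mul_inv]
          _ = ((M : ℝ) * N) ^ e * (g : ℝ) ^ (-(2 * e)) := by
              rw [← Real.rpow_natCast (g : ℝ) 2, ← Real.rpow_mul hg0.le, ← Real.rpow_neg hg0.le]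
              push_cast; ring_nf
          _ ≤ ((M : ℝ) * N) ^ e * (g : ℝ) ^ (-(11 / 6 : ℝ)) := by
              refine mul_le_mul_of_nonneg_left ?_ (by positivity)
              exact Real.rpow_le_rpow_of_exponent_le hgr (by rw [he]; linarith)
      calc C * ((M : ℝ) + Np) ^ (1 / 12 : ℝ) * ((M : ℝ) * Np) ^ (11 / 12 + ε)
          ≤ C * ((M : ℝ) + N) ^ (1 / 12 : ℝ) * (((M : ℝ) * N) ^ e * (g : ℝ) ^ (-(11 / 6 : ℝ))) := by
            rw [← he]; gcongr
        _ = C * R * (g : ℝ) ^ (-(11 / 6 : ℝ)) := by rw [hR]; ring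
    refine (norm_sum_le _ _).trans ((sum_le_sum hpiece).trans ?_)
    rw [sum_product]
    have hinner : ∀ g ∈ Icc 1 N, ∑ ρ ∈ unitClasses, C * R * (g : ℝ) ^ (-(11 / 6 : ℝ)) ≤ 8 * (C * R * (g : ℝ) ^ (-(11 / 6 : ℝ))) := by
      intro g _
      rw [sum_const, nsmul_eq_mul]
      have : (#unitClasses : ℝ) ≤ 8 := by exact_mod_cast card_unitClasses_le
      exact mul_le_mul_of_nonneg_right this (by positivity)
    refine (sum_le_sum hinner).trans ?_
    rw [← mul_sum]
    have hZs : ∑ g ∈ Icc 1 N, C * R * (g : ℝ) ^ (-(11 / 6 : ℝ)) ≤ C * R * Z := by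
      rw [← mul_sum, hZ]
      refine mul_le_mul_of_nonneg_left ?_ (by positivity)
      exact hsum.sum_le_tsum _ fun g _ => by positivity
    nlinarith
  calc ‖dirichletBilin α β (ppDisc M) (gaussDisc N)‖
      = ‖β 0 * A 0 + ∑ z ∈ (gaussDisc N).erase 0, β z * A z‖ := by rw [hQ]
    _ ≤ ‖β 0 * A 0‖ + ‖∑ z ∈ (gaussDisc N).erase 0, β z * A z‖ := norm_add_le _ _
    _ ≤ 1 + 8 * C * Z * R := add_le_add h0 hmain
    _ ≤ (1 + 8 * C * Z) * R := by nlinarith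
    _ = (1 + 8 * C * Z) * ((M : ℝ) + N) ^ (1 / 12 : ℝ) * ((M : ℝ) * N) ^ (11 / 12 + ε) := by rw [hR, he]; ring

end Literature.NumberTheory.Sieve.FriedlanderIwaniecPrimes

end
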